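import Summits.Parity.BatemanHorn.Theses.RoughParitySectors
import Literature.NumberTheory.Sieve.IntervalResidueClassSieveSigned
import HarnessLib

/-!
# Route `RoughParitySectors`, crux `RoughParityBalance` (stmt-Parity-15627), line `registered` (birth):
# the registered engine stub `stub_signedSieveOut` — signed sieve-out along a Bateman–Horn system

`--supports` file of the checked skeleton
`Summits/Parity/BatemanHorn/Cruxes/RoughParityBalance/Lines/birth.lean`
(crux `Summit.Parity.BatemanHorn.Theses.RoughParitySectors.RoughParityBalance`).  It PROVES the registered
stub `stub_signedSieveOut`, verbatim: for every Bateman–Horn system `f = (f₁,…,f_k)`, every `ε > 0` and every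
level exponent `0 < θ ≤ 1/4` there is `U₁` such that for every `U ≥ U₁`, eventually in `x`, for EVERY weight
`σ : ℕ → ℝ` with `|σ| ≤ 1`,

  `|Σ_{n ∈ R_f(x,U)} σ(n)| ≤ ε·#R_f(x,U) + Σ_{d ≤ x^θ squarefree} Σ_{c mod d : d ∣ ∏ᵢ fᵢ(c)} |Σ_{n ≤ x, n ≡ c (d)} σ(n)|`,

where `R_f(x,U) = {1 ≤ n ≤ x : ∀ i, fᵢ(n) > 0 ∧ no prime p < x^{deg fᵢ/U} divides fᵢ(n)}` is the jointly rough
set of the crux (staggered thresholds).  This is the SIGNED twin of the banked band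
`Cruxes.RoughValueLaw.IncrementAnchoring.stub_sieveBand` and its proof is the same dictionary fed with the
signed interval residue-class sieve `IntervalClassSieve.abs_signedSum_le` instead of the counting one.

## The argument

1. Classes `Ω p = {r mod p : ∃ i, p < x^{deg fᵢ/U} ∧ p ∣ fᵢ(r)}` (`#Ω p ≤ S = Σ deg fᵢ`, `#Ω p < p`:
   `SieveBand.card_classes_le_sum/lt`), sifting level `z = x^{S/U}`, level of distribution `L = x^θ`
   (`U ≥ S/θ` gives `z ≤ L`; `s = log L/log z = θU/S` and `C e^{−s} ≤ ε/4` once `U ≥ (S/θ)·log(4C/ε)`).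
2. `IntervalClassSieve.abs_signedSum_le`: `|Σ_{n ≤ x sifted} σ| ≤ C x V(z) e^{−s} + L² + Σ_{d∣P(z), d≤L} Σ_{c adm} |Σ_{n≡c(d)} σ|`.
3. The crux's set `R` is the sifted set minus at most `n₀` small `n` (`SieveBand.rough_iff`, positivity threshold
   `SieveBand.exists_forall_eval_pos`), so the two signed sums differ by `≤ n₀`.
4. `V(z) = V_f(x,U)` (`SieveBand.prod_eq_prod_primesBelow`), the band at `1/2` gives `xV ≤ 2#R`, and
   `V ≥ c/(log x)^{2S}` (`IntervalClassSieve.le_prod_one_sub_card_div`) with `SieveBand.eventually_absorb` absorbs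
   `n₀ + L²` into `(ε/4)·xV`; total `≤ ε·#R`.
5. An admissible class `c mod d` (`d ∣ P(z)`, so squarefree) has `d ∣ ∏ᵢ fᵢ(c)`, and `d ≤ L` gives `d ≤ ⌊x^θ⌋₊`:
   the generic remainder is a sub-sum of the stub's remainder (non-negative terms).

References: H. Halberstam, H.-E. Richert, *Sieve Methods* (1974), Thm 2.5; J. Friedlander, H. Iwaniec,
*Opera de Cribro* (2010), Cor. 6.10.
-/

open Filter Finset Polynomial
open scoped Topology BigOperators Classical
open Literature.NumberTheory.Sieve

namespace Summit.Parity.BatemanHorn.Cruxes.RoughParityBalance.Birth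

open Summit.Parity.BatemanHorn.Cruxes.RoughValueLaw.IncrementAnchoring (stub_sieveBand)
open Summit.Parity.BatemanHorn.Cruxes.RoughValueLaw.IncrementAnchoring.SieveBand

namespace SignedSieveOut

/-! ### Admissible classes are root classes of the product -/

/-- If `d` is squarefree and every prime `q ∣ d` has `c mod q ∈ Ω q`, where `Ω q` consists of residues at
which some member `fᵢ` vanishes modulo `q`, then `d ∣ ∏ᵢ fᵢ(c)`. [folklore] -/
theorem dvd_prod_eval_of_admissible {k : ℕ} (f : Fin k → ℤ[X]) (P : ℕ → Fin k → Prop)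
    {d : ℕ} (hd : Squarefree d) {c : ℕ}
    (hc : ∀ q ∈ d.primeFactors, c % q ∈
      (range q).filter (fun r : ℕ => ∃ i, P q i ∧ (q : ℤ) ∣ (f i).eval (r : ℤ))) :
    (d : ℤ) ∣ (∏ i, f i).eval (c : ℤ) := by
  rw [Int.natCast_dvd, ← Nat.prod_primeFactors_of_squarefree hd]
  refine Finset.prod_primes_dvd _ (fun q hq => (Nat.prime_of_mem_primeFactors hq).prime) fun q hq => ?_
  have hmem := hc q hq
  rw [mem_filter] at hmem
  obtain ⟨-, i, -, hdvd⟩ := hmem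
  rw [← dvd_eval_iff_dvd_eval_mod (f i) q c] at hdvd
  rw [← Int.natCast_dvd, eval_prod]
  exact hdvd.trans (Finset.dvd_prod_of_mem (fun j => (f j).eval (c : ℤ)) (mem_univ i))

/-- The generic remainder (moduli `d ∣ P(z)`, `d ≤ L`, admissible classes) is a sub-sum of the stub's remainder
(squarefree `d ≤ ⌊L⌋₊`, root classes of `∏ fᵢ`): all terms are non-negative. [folklore] -/
theorem remainder_le {k : ℕ} (f : Fin k → ℤ[X]) (P : ℕ → Fin k → Prop) (z L : ℝ) (x : ℕ)
    (σ : ℕ → ℝ) :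
    ∑ d ∈ (primesProdBelow z).divisors.filter (fun d : ℕ => (d : ℝ) ≤ L),
        ∑ c ∈ (range d).filter (fun c : ℕ => ∀ q ∈ d.primeFactors, c % q ∈
          (range q).filter (fun r : ℕ => ∃ i, P q i ∧ (q : ℤ) ∣ (f i).eval (r : ℤ))),
          |∑ n ∈ (Icc 1 x).filter (fun n : ℕ => n % d = c), σ n| ≤
      ∑ d ∈ (Icc 1 ⌊L⌋₊).filter Squarefree,
        ∑ c ∈ (range d).filter (fun c : ℕ => (d : ℤ) ∣ (∏ i, f i).eval (c : ℤ)),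
          |∑ n ∈ (Icc 1 x).filter (fun n : ℕ => n % d = c), σ n| := by
  have hsub : (primesProdBelow z).divisors.filter (fun d : ℕ => (d : ℝ) ≤ L) ⊆
      (Icc 1 ⌊L⌋₊).filter Squarefree := by
    intro d hd
    rw [mem_filter, Nat.mem_divisors] at hd
    rw [mem_filter, mem_Icc]
    exact ⟨⟨Nat.pos_of_dvd_of_pos hd.1.1 (Nat.pos_of_ne_zero hd.1.2), Nat.le_floor hd.2⟩,
      (squarefree_primesProdBelow z).squarefree_of_dvd hd.1.1⟩
  refine le_trans (Finset.sum_le_sum fun d hd => ?_)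
    (Finset.sum_le_sum_of_subset_of_nonneg hsub fun d _ _ =>
      Finset.sum_nonneg fun c _ => abs_nonneg _)
  have hdsq : Squarefree d :=
    (squarefree_primesProdBelow z).squarefree_of_dvd (Nat.mem_divisors.mp (mem_filter.mp hd).1).1
  refine Finset.sum_le_sum_of_subset_of_nonneg (fun c hc => ?_) fun c _ _ => abs_nonneg _
  rw [mem_filter] at hc ⊢
  exact ⟨hc.1, dvd_prod_eval_of_admissible f P hdsq hc.2⟩

/-- The crux's rough set is contained in the sifted set (thresholds `wᵢ ≤ z`). [folklore] -/
theorem rough_subset {k : ℕ} (f : Fin k → ℤ[X]) {w : Fin k → ℝ} {z : ℝ} (hwz : ∀ i, w i ≤ z) (x : ℕ) :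
    (Icc 1 x).filter (fun n : ℕ => ∀ i, 0 < (f i).eval (n : ℤ) ∧
        ∀ p ∈ range ⌈w i⌉₊, p.Prime → ¬ ((p : ℤ) ∣ (f i).eval (n : ℤ))) ⊆
      (Icc 1 x).filter (fun n : ℕ => ∀ p ∈ Nat.primesBelow ⌈z⌉₊, n % p ∉
        (range p).filter (fun r : ℕ => ∃ i, (p : ℝ) < w i ∧ (p : ℤ) ∣ (f i).eval (r : ℤ))) := by
  intro n hn
  rw [mem_filter] at hn ⊢
  exact ⟨hn.1, (rough_iff f hwz n).mpr fun i => (hn.2 i).2⟩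

/-- The sifted set exceeds the crux's rough set by fewer than `n₀` elements (all below the positivity
threshold `n₀`). [folklore] -/
theorem card_sdiff_rough_le {k : ℕ} (f : Fin k → ℤ[X]) {w : Fin k → ℝ} {z : ℝ} (hwz : ∀ i, w i ≤ z)
    (x : ℕ) {n₀ : ℕ} (hn₀ : ∀ i, ∀ n : ℕ, n₀ ≤ n → 0 < (f i).eval (n : ℤ)) :
    #(((Icc 1 x).filter (fun n : ℕ => ∀ p ∈ Nat.primesBelow ⌈z⌉₊, n % p ∉
        (range p).filter (fun r : ℕ => ∃ i, (p : ℝ) < w i ∧ (p : ℤ) ∣ (f i).eval (r : ℤ)))) \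
      ((Icc 1 x).filter (fun n : ℕ => ∀ i, 0 < (f i).eval (n : ℤ) ∧
        ∀ p ∈ range ⌈w i⌉₊, p.Prime → ¬ ((p : ℤ) ∣ (f i).eval (n : ℤ))))) ≤ n₀ := by
  calc _ ≤ #(range n₀) := by
        refine card_le_card fun n hn => ?_
        obtain ⟨hn1, hn2⟩ := Finset.mem_sdiff.mp hn
        rw [mem_filter] at hn1 hn2
        rw [mem_range]
        by_contra hlt
        exact hn2 ⟨hn1.1, fun i => ⟨hn₀ i n (not_lt.mp hlt), (rough_iff f hwz n).mp hn1.2 i⟩⟩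
    _ = n₀ := card_range n₀

/-- Signed sums over nested sets differ by at most the size of the difference, for `|σ| ≤ 1`. [folklore] -/
theorem abs_sum_sub_sum_le {s t : Finset ℕ} (hst : s ⊆ t) (σ : ℕ → ℝ) (hσ : ∀ n, |σ n| ≤ 1) :
    |∑ n ∈ s, σ n - ∑ n ∈ t, σ n| ≤ #(t \ s) := by
  rw [← Finset.sum_sdiff hst, show ∑ n ∈ s, σ n - (∑ n ∈ t \ s, σ n + ∑ n ∈ s, σ n) =
    -∑ n ∈ t \ s, σ n by ring, abs_neg]
  calc |∑ n ∈ t \ s, σ n| ≤ ∑ n ∈ t \ s, |σ n| := abs_sum_le_sum_abs _ _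
    _ ≤ ∑ _n ∈ t \ s, (1 : ℝ) := Finset.sum_le_sum fun n _ => hσ n
    _ = #(t \ s) := by rw [sum_const, nsmul_eq_mul, mul_one]


/-! ### The signed estimate at a fixed `x` (assembly) -/

/-- **The signed sieve-out at a fixed `x`.**  Given thresholds `wᵢ ≤ z ≤ x`, `z ≥ 2`, the signed residue-class
sieve bound for the classes `Ω` (`hgen`, with an arbitrary remainder `Rm`), `C e^{−s} ≤ ε/4`, the lower bound
`V(z) ≥ c/(log z)^{2S}`, the absorption `(n₀ + L²)(log x)^{2S} ≤ (εc/4) x` and the band `|#R − xV| ≤ xV/2`, the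
signed sum over the crux's rough set is at most `ε·#R + Rm`. [folklore] -/
theorem signed_at {k : ℕ} (f : Fin k → ℤ[X]) (w : Fin k → ℝ) {z L C c ε s Rm : ℝ} {x n₀ S : ℕ}
    (σ : ℕ → ℝ) (hσ : ∀ n, |σ n| ≤ 1)
    (hwz : ∀ i, w i ≤ z) (hz2 : 2 ≤ z) (hzx : z ≤ x)
    (hn₀ : ∀ i, ∀ n : ℕ, n₀ ≤ n → 0 < (f i).eval (n : ℤ))
    (hgen : |∑ n ∈ (Icc 1 x).filter (fun n : ℕ => ∀ p ∈ Nat.primesBelow ⌈z⌉₊, n % p ∉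
        (range p).filter (fun r : ℕ => ∃ i, (p : ℝ) < w i ∧ (p : ℤ) ∣ (f i).eval (r : ℤ))), σ n| ≤
        C * x * (∏ p ∈ Nat.primesBelow ⌈z⌉₊, (1 - (#((range p).filter (fun r : ℕ => ∃ i,
            (p : ℝ) < w i ∧ (p : ℤ) ∣ (f i).eval (r : ℤ))) : ℝ) / p)) * Real.exp (-s) + L ^ 2 + Rm)
    (hCs : C * Real.exp (-s) ≤ ε / 4)
    (hlow : c / Real.log z ^ (2 * S) ≤ ∏ p ∈ Nat.primesBelow ⌈z⌉₊, (1 - (#((range p).filter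
        (fun r : ℕ => ∃ i, (p : ℝ) < w i ∧ (p : ℤ) ∣ (f i).eval (r : ℤ))) : ℝ) / p))
    (hc : 0 < c) (hε : 0 < ε)
    (habs : ((n₀ : ℝ) + L ^ 2) * Real.log x ^ (2 * S) ≤ ε * c / 4 * x)
    (hband : |((#((Icc 1 x).filter (fun n : ℕ => ∀ i, 0 < (f i).eval (n : ℤ) ∧
          ∀ p ∈ range ⌈w i⌉₊, p.Prime → ¬ ((p : ℤ) ∣ (f i).eval (n : ℤ))))) : ℝ) -
        (x : ℝ) * ∏ p ∈ Nat.primesBelow (x + 1), (1 - (#((range p).filter (fun r : ℕ => ∃ i,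
          (p : ℝ) < w i ∧ (p : ℤ) ∣ (f i).eval (r : ℤ))) : ℝ) / (p : ℝ))| ≤
      1 / 2 * ((x : ℝ) * ∏ p ∈ Nat.primesBelow (x + 1), (1 - (#((range p).filter (fun r : ℕ => ∃ i,
          (p : ℝ) < w i ∧ (p : ℤ) ∣ (f i).eval (r : ℤ))) : ℝ) / (p : ℝ)))) :
    |∑ n ∈ (Icc 1 x).filter (fun n : ℕ => ∀ i, 0 < (f i).eval (n : ℤ) ∧
          ∀ p ∈ range ⌈w i⌉₊, p.Prime → ¬ ((p : ℤ) ∣ (f i).eval (n : ℤ))), σ n| ≤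
      ε * ((#((Icc 1 x).filter (fun n : ℕ => ∀ i, 0 < (f i).eval (n : ℤ) ∧
          ∀ p ∈ range ⌈w i⌉₊, p.Prime → ¬ ((p : ℤ) ∣ (f i).eval (n : ℤ)))) : ℕ) : ℝ) + Rm := by
  have hzx1 : z ≤ (x : ℝ) + 1 := by linarith
  rw [← prod_eq_prod_primesBelow f hwz hzx1] at hband
  set V : ℝ := ∏ p ∈ Nat.primesBelow ⌈z⌉₊, (1 - (#((range p).filter (fun r : ℕ => ∃ i,
    (p : ℝ) < w i ∧ (p : ℤ) ∣ (f i).eval (r : ℤ))) : ℝ) / p) with hV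
  set Q : Finset ℕ := (Icc 1 x).filter (fun n : ℕ => ∀ p ∈ Nat.primesBelow ⌈z⌉₊, n % p ∉
    (range p).filter (fun r : ℕ => ∃ i, (p : ℝ) < w i ∧ (p : ℤ) ∣ (f i).eval (r : ℤ))) with hQ
  set R : Finset ℕ := (Icc 1 x).filter (fun n : ℕ => ∀ i, 0 < (f i).eval (n : ℤ) ∧
    ∀ p ∈ range ⌈w i⌉₊, p.Prime → ¬ ((p : ℤ) ∣ (f i).eval (n : ℤ))) with hR
  have hx2 : (2 : ℝ) ≤ x := hz2.trans hzx
  have hx0 : (0 : ℝ) < x := by linarith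
  have hlogz : 0 < Real.log z := Real.log_pos (by linarith)
  have hlogx : 0 < Real.log x := Real.log_pos (by linarith)
  have hlogzx : Real.log z ^ (2 * S) ≤ Real.log x ^ (2 * S) :=
    pow_le_pow_left₀ hlogz.le (Real.log_le_log (by linarith) hzx) _
  have hLz : 0 < Real.log z ^ (2 * S) := pow_pos hlogz _
  have hLx : 0 < Real.log x ^ (2 * S) := pow_pos hlogx _
  -- the lower bound for `V` and the absorption of the additive errors
  have hVc : c / Real.log x ^ (2 * S) ≤ V :=
    (div_le_div_of_nonneg_left hc.le hLz hlogzx).trans hlow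
  have hV0 : 0 < V := lt_of_lt_of_le (div_pos hc hLx) hVc
  have hxV : 0 ≤ (x : ℝ) * V := by positivity
  have hsmall : (n₀ : ℝ) + L ^ 2 ≤ ε / 4 * ((x : ℝ) * V) := by
    have h1 : (n₀ : ℝ) + L ^ 2 ≤ ε * c / 4 * x / Real.log x ^ (2 * S) := by
      rw [le_div_iff₀ hLx]; exact habs
    have h2 : ε * c / 4 * x / Real.log x ^ (2 * S) = ε / 4 * ((x : ℝ) * (c / Real.log x ^ (2 * S))) := by
      ring
    rw [h2] at h1
    exact h1.trans (mul_le_mul_of_nonneg_left (mul_le_mul_of_nonneg_left hVc hx0.le) (by linarith))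
  -- the main error
  have hmain : C * x * V * Real.exp (-s) ≤ ε / 4 * ((x : ℝ) * V) := by
    calc C * x * V * Real.exp (-s) = C * Real.exp (-s) * ((x : ℝ) * V) := by ring
      _ ≤ ε / 4 * ((x : ℝ) * V) := mul_le_mul_of_nonneg_right hCs hxV
  -- the band: `xV ≤ 2 #R`
  have hRV : (x : ℝ) * V ≤ 2 * (#R : ℝ) := by
    have h := (abs_le.mp hband).1
    linarith
  -- the two signed sums differ by at most `n₀`
  have hRQ : R ⊆ Q := rough_subset f hwz x
  have hdiff : |∑ n ∈ R, σ n - ∑ n ∈ Q, σ n| ≤ n₀ := by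
    refine (abs_sum_sub_sum_le hRQ σ hσ).trans ?_
    exact_mod_cast card_sdiff_rough_le f hwz x hn₀
  have htri : |∑ n ∈ R, σ n| ≤ |∑ n ∈ Q, σ n| + n₀ := by
    have := abs_sub_abs_le_abs_sub (∑ n ∈ R, σ n) (∑ n ∈ Q, σ n)
    linarith
  calc |∑ n ∈ R, σ n| ≤ |∑ n ∈ Q, σ n| + n₀ := htri
    _ ≤ C * x * V * Real.exp (-s) + L ^ 2 + Rm + n₀ := by linarith [hgen]
    _ ≤ ε / 4 * ((x : ℝ) * V) + ε / 4 * ((x : ℝ) * V) + Rm := by linarith [hmain, hsmall]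
    _ ≤ ε * (#R : ℝ) + Rm := by nlinarith [hRV, hε.le]

end SignedSieveOut

open SignedSieveOut in
/-- **E2 — `stub_signedSieveOut`: signed sieve-out along a Bateman–Horn system** (the registered engine stub of
the line `registered`, verbatim).  For every Bateman–Horn system `f`, every `ε > 0` and every `0 < θ ≤ 1/4` there
is `U₁` such that for every `U ≥ U₁`, eventually in `x`, for every weight `|σ| ≤ 1`,
`|Σ_{n ∈ R_f(x,U)} σ(n)| ≤ ε·#R_f(x,U) + Σ_{d ≤ x^θ sqfree} Σ_{c mod d : d ∣ ∏ᵢ fᵢ(c)} |Σ_{n ≤ x, n ≡ c (d)} σ(n)|`.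
Proof: `SignedSieveOut.signed_at` fed with the signed residue-class sieve `IntervalClassSieve.abs_signedSum_le`
(classes `Ω p = {r : ∃ i, p < x^{deg fᵢ/U}, p ∣ fᵢ(r)}`, `z = x^{S/U}`, `L = x^θ`,
`U₁ = max(U_band(1/2), S/θ, (S/θ) log(4C/ε))`), the lower bound `IntervalClassSieve.le_prod_one_sub_card_div`,
`SieveBand.eventually_absorb`, the band `IncrementAnchoring.stub_sieveBand` at `1/2`, and
`SignedSieveOut.remainder_le`; `k = 0`: the `d = 1` term of the remainder is the whole sum. [folklore] -/
theorem stub_signedSieveOut :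
    ∀ (k : ℕ) (f : Fin k → Polynomial ℤ), IsBatemanHornSystem f →
      ∀ ε : ℝ, 0 < ε → ∀ θ : ℝ, 0 < θ → θ ≤ 1 / 4 → ∃ U₁ : ℝ, ∀ U : ℝ, U₁ ≤ U →
        ∀ᶠ x : ℕ in Filter.atTop, ∀ σ : ℕ → ℝ, (∀ n, |σ n| ≤ 1) →
          |∑ n ∈ (Finset.Icc 1 x).filter (fun n : ℕ => ∀ i, 0 < (f i).eval (n : ℤ) ∧
              ∀ p ∈ Finset.range ⌈(x : ℝ) ^ (((f i).natDegree : ℝ) / U)⌉₊,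
                p.Prime → ¬ ((p : ℤ) ∣ (f i).eval (n : ℤ))), σ n| ≤
            ε * ((((Finset.Icc 1 x).filter (fun n : ℕ => ∀ i, 0 < (f i).eval (n : ℤ) ∧
              ∀ p ∈ Finset.range ⌈(x : ℝ) ^ (((f i).natDegree : ℝ) / U)⌉₊,
                p.Prime → ¬ ((p : ℤ) ∣ (f i).eval (n : ℤ)))).card : ℕ) : ℝ) +
            ∑ d ∈ (Finset.Icc 1 ⌊(x : ℝ) ^ θ⌋₊).filter Squarefree,
              ∑ c ∈ (Finset.range d).filter (fun c : ℕ => (d : ℤ) ∣ (∏ i, f i).eval (c : ℤ)),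
                |∑ n ∈ (Finset.Icc 1 x).filter (fun n : ℕ => n % d = c), σ n| := by
  intro k f hf ε hε θ hθ hθ4
  rcases Nat.eq_zero_or_pos k with hk | hk
  · -- `k = 0`: the `d = 1`, `c = 0` term of the remainder is `|Σ_{n ≤ x} σ n|` itself
    subst hk
    refine ⟨0, fun U _ => ?_⟩
    filter_upwards [Filter.eventually_ge_atTop 1] with x hx1 σ hσ
    have hx1' : (1 : ℝ) ≤ (x : ℝ) ^ θ := Real.one_le_rpow (by exact_mod_cast hx1) hθ.le
    have h1mem : (1 : ℕ) ∈ (Finset.Icc 1 ⌊(x : ℝ) ^ θ⌋₊).filter Squarefree := by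
      rw [mem_filter, mem_Icc]
      exact ⟨⟨le_rfl, Nat.le_floor (by exact_mod_cast hx1')⟩, squarefree_one⟩
    have hR : (Finset.Icc 1 x).filter (fun n : ℕ => ∀ i : Fin 0, 0 < (f i).eval (n : ℤ) ∧
        ∀ p ∈ Finset.range ⌈(x : ℝ) ^ (((f i).natDegree : ℝ) / U)⌉₊,
          p.Prime → ¬ ((p : ℤ) ∣ (f i).eval (n : ℤ))) = Finset.Icc 1 x :=
      Finset.filter_true_of_mem fun n _ i => i.elim0
    have hc0 : (Finset.range 1).filter (fun c : ℕ => ((1 : ℕ) : ℤ) ∣ (∏ i : Fin 0, f i).eval (c : ℤ)) =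
        {0} := by
      rw [Finset.filter_true_of_mem fun c _ => by simp, Finset.range_one]
    have hinner : (Finset.Icc 1 x).filter (fun n : ℕ => n % 1 = 0) = Finset.Icc 1 x :=
      Finset.filter_true_of_mem fun n _ => Nat.mod_one n
    rw [hR]
    calc |∑ n ∈ Finset.Icc 1 x, σ n|
        = ∑ c ∈ (Finset.range 1).filter (fun c : ℕ => ((1 : ℕ) : ℤ) ∣ (∏ i : Fin 0, f i).eval (c : ℤ)),
            |∑ n ∈ (Finset.Icc 1 x).filter (fun n : ℕ => n % 1 = c), σ n| := by
          rw [hc0, sum_singleton, hinner]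
      _ ≤ ∑ d ∈ (Finset.Icc 1 ⌊(x : ℝ) ^ θ⌋₊).filter Squarefree,
            ∑ c ∈ (Finset.range d).filter (fun c : ℕ => (d : ℤ) ∣ (∏ i : Fin 0, f i).eval (c : ℤ)),
              |∑ n ∈ (Finset.Icc 1 x).filter (fun n : ℕ => n % d = c), σ n| :=
          Finset.single_le_sum (f := fun d => ∑ c ∈ (Finset.range d).filter
              (fun c : ℕ => (d : ℤ) ∣ (∏ i : Fin 0, f i).eval (c : ℤ)),
            |∑ n ∈ (Finset.Icc 1 x).filter (fun n : ℕ => n % d = c), σ n|)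
            (fun d _ => Finset.sum_nonneg fun c _ => abs_nonneg _) h1mem
      _ ≤ _ := by
          have : (0 : ℝ) ≤ ε * ((#(Finset.Icc 1 x) : ℕ) : ℝ) := by positivity
          linarith
  -- `k ≥ 1`: the degrees
  set S : ℕ := ∑ i, (f i).natDegree with hS
  have hSpos : 0 < S := by
    rw [hS]
    exact Finset.sum_pos (fun i _ => hf.natDegree_pos i) ⟨⟨0, hk⟩, mem_univ _⟩
  have hS0 : (0 : ℝ) < S := by exact_mod_cast hSpos
  obtain ⟨C, hC, hFL⟩ := IntervalClassSieve.abs_signedSum_le S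
  obtain ⟨c, hc, hlow⟩ := IntervalClassSieve.le_prod_one_sub_card_div S
  obtain ⟨n₀, hn₀⟩ := exists_forall_eval_pos hf
  obtain ⟨Ub, hUb⟩ := stub_sieveBand k f hf (1 / 2) (by norm_num)
  refine ⟨max (max Ub (S / θ)) (S / θ * Real.log (4 * C / ε)), fun U hU => ?_⟩
  have hUb' : Ub ≤ U := le_trans (le_trans (le_max_left _ _) (le_max_left _ _)) hU
  have hUS : (S : ℝ) / θ ≤ U := le_trans (le_trans (le_max_right _ _) (le_max_left _ _)) hU
  have hUlog : S / θ * Real.log (4 * C / ε) ≤ U := le_trans (le_max_right _ _) hU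
  have hSθ : 0 < (S : ℝ) / θ := div_pos hS0 hθ
  have hU0 : 0 < U := lt_of_lt_of_le hSθ hUS
  have hSU : (S : ℝ) / U ≤ θ := by
    rw [div_le_iff₀ hU0]
    have := (div_le_iff₀ hθ).mp hUS
    linarith
  have hSU0 : 0 < (S : ℝ) / U := div_pos hS0 hU0
  have hSU1 : (S : ℝ) / U ≤ 1 := hSU.trans (hθ4.trans (by norm_num))
  -- the main error: `C e^{-θU/S} ≤ ε/4`
  have hCs : C * Real.exp (-(θ * U / S)) ≤ ε / 4 := by
    have h1 : Real.log (4 * C / ε) ≤ θ * U / S := by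
      rw [le_div_iff₀ hS0]
      have h := mul_le_mul_of_nonneg_left hUlog hθ.le
      have e : θ * ((S : ℝ) / θ * Real.log (4 * C / ε)) = Real.log (4 * C / ε) * S := by
        field_simp
      linarith
    have h2 : Real.exp (-(θ * U / S)) ≤ ε / (4 * C) := by
      calc Real.exp (-(θ * U / S)) ≤ Real.exp (-Real.log (4 * C / ε)) :=
            Real.exp_le_exp.mpr (by linarith)
        _ = ε / (4 * C) := by
            rw [Real.exp_neg, Real.exp_log (by positivity), inv_div]
    calc C * Real.exp (-(θ * U / S)) ≤ C * (ε / (4 * C)) :=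
          mul_le_mul_of_nonneg_left h2 hC.le
      _ = ε / 4 := by field_simp
  -- eventual conditions on `x`
  have hz2 : ∀ᶠ x : ℕ in atTop, (2 : ℝ) ≤ (x : ℝ) ^ ((S : ℝ) / U) :=
    ((tendsto_rpow_atTop hSU0).comp tendsto_natCast_atTop_atTop).eventually_ge_atTop 2
  have habs := eventually_absorb (2 * S) n₀ (by positivity : 0 < ε * c / 4)
  filter_upwards [hz2, habs, eventually_ge_atTop 2, hUb U hUb'] with x hzx habsx hx2 hbandx σ hσ
  have hx1 : (1 : ℝ) ≤ x := by exact_mod_cast le_trans one_le_two hx2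
  have hx0 : (0 : ℝ) < x := by linarith
  -- thresholds `wᵢ = x^{dᵢ/U} ≤ z = x^{S/U} ≤ L = x^θ ≤ x^{1/4}`, `z ≤ x`
  have hdS : ∀ i, ((f i).natDegree : ℝ) ≤ S := fun i => by
    rw [hS]
    exact_mod_cast Finset.single_le_sum (f := fun j => (f j).natDegree) (fun j _ => Nat.zero_le _)
      (mem_univ i)
  have hwz : ∀ i, (x : ℝ) ^ (((f i).natDegree : ℝ) / U) ≤ (x : ℝ) ^ ((S : ℝ) / U) := fun i =>
    Real.rpow_le_rpow_of_exponent_le hx1 (div_le_div_of_nonneg_right (hdS i) hU0.le)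
  have hzL : (x : ℝ) ^ ((S : ℝ) / U) ≤ (x : ℝ) ^ θ := Real.rpow_le_rpow_of_exponent_le hx1 hSU
  have hL4 : (x : ℝ) ^ θ ≤ (x : ℝ) ^ (1 / 4 : ℝ) := Real.rpow_le_rpow_of_exponent_le hx1 hθ4
  have hzx' : (x : ℝ) ^ ((S : ℝ) / U) ≤ x := by
    conv_rhs => rw [← Real.rpow_one (x : ℝ)]
    exact Real.rpow_le_rpow_of_exponent_le hx1 hSU1
  have hs : Real.log ((x : ℝ) ^ θ) / Real.log ((x : ℝ) ^ ((S : ℝ) / U)) = θ * U / S := by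
    have hlogx : 0 < Real.log x := Real.log_pos (by linarith)
    rw [Real.log_rpow hx0, Real.log_rpow hx0]
    field_simp
  -- the classes
  have hΩlt : ∀ p : ℕ, p.Prime → ∀ r ∈ (range p).filter (fun r : ℕ => ∃ i,
      (p : ℝ) < (x : ℝ) ^ (((f i).natDegree : ℝ) / U) ∧ (p : ℤ) ∣ (f i).eval (r : ℤ)), r < p :=
    fun p _ r hr => mem_range.mp (mem_filter.mp hr).1
  have hΩle : ∀ p : ℕ, p.Prime → #((range p).filter (fun r : ℕ => ∃ i,
      (p : ℝ) < (x : ℝ) ^ (((f i).natDegree : ℝ) / U) ∧ (p : ℤ) ∣ (f i).eval (r : ℤ))) ≤ S :=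
    fun p hp => by
      rw [hS]
      exact card_classes_le_sum hf hp (fun i => (p : ℝ) < (x : ℝ) ^ (((f i).natDegree : ℝ) / U))
  have hΩp : ∀ p : ℕ, p.Prime → #((range p).filter (fun r : ℕ => ∃ i,
      (p : ℝ) < (x : ℝ) ^ (((f i).natDegree : ℝ) / U) ∧ (p : ℤ) ∣ (f i).eval (r : ℤ))) < p :=
    fun p hp => card_classes_lt hf hp (fun i => (p : ℝ) < (x : ℝ) ^ (((f i).natDegree : ℝ) / U))
  have hgen := hFL x (fun p => (range p).filter (fun r : ℕ => ∃ i,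
      (p : ℝ) < (x : ℝ) ^ (((f i).natDegree : ℝ) / U) ∧ (p : ℤ) ∣ (f i).eval (r : ℤ)))
    hΩlt hΩle hΩp _ _ hzx hzL σ hσ
  have hlowx := hlow (fun p => (range p).filter (fun r : ℕ => ∃ i,
      (p : ℝ) < (x : ℝ) ^ (((f i).natDegree : ℝ) / U) ∧ (p : ℤ) ∣ (f i).eval (r : ℤ)))
    hΩle hΩp _ hzx
  rw [hs] at hgen
  -- the absorption with `L = x^θ ≤ x^{1/4}`
  have habsx' : ((n₀ : ℝ) + ((x : ℝ) ^ θ) ^ 2) * Real.log x ^ (2 * S) ≤ ε * c / 4 * x := by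
    refine le_trans (mul_le_mul_of_nonneg_right ?_ (pow_nonneg (Real.log_nonneg hx1) _)) habsx
    have h0 : 0 ≤ (x : ℝ) ^ θ := Real.rpow_nonneg hx0.le _
    nlinarith [hL4, h0]
  -- the generic remainder is a sub-sum of the stub's remainder
  have hrem := remainder_le f (fun (p : ℕ) (i : Fin k) => (p : ℝ) < (x : ℝ) ^ (((f i).natDegree : ℝ) / U))
    ((x : ℝ) ^ ((S : ℝ) / U)) ((x : ℝ) ^ θ) x σ
  have hgen' := le_trans hgen (add_le_add_right hrem _)
  exact signed_at f (fun i => (x : ℝ) ^ (((f i).natDegree : ℝ) / U)) σ hσ hwz hzx hzx' hn₀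
    hgen' hCs hlowx hc hε habsx' hbandx

end Summit.Parity.BatemanHorn.Cruxes.RoughParityBalance.Birth
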